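import Literature.Analysis.FluidPDE.TaoWeightedEulerForm
import Literature.Analysis.FluidPDE.TaoSymbolLocalisation
import HarnessLib

/-!
# Tao 2016, §3.4: the frequency geometry of the single-scale reduction ("if `ε₀` is small enough")

T. Tao, *Finite time blowup for an averaged three-dimensional Navier–Stokes equation*,
J. Amer. Math. Soc. **29** (2016), 601–674 = arXiv:1402.0290v3 (held as `paper:arxiv-1402.0290`),
§3.3–§3.4 pp. 16–17: "thus `η(|ξ₁|,|ξ₂|,|ξ₃|)` is only non-vanishing when `ξ₁, ξ₂, ξ₃` have
comparable magnitude"; "`ρ` is supported on the union of the balls `(1+ε₀)ⁿ · B(ξ₁⁰, 2ε₀²)`";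
cross terms are "vanishing otherwise if `ε₀` is small enough (thanks to the support properties of
`m_{i,ω,n}`, `η` and `ρ`)". This support file for the discharge of `cascade_of_singleScale`
(`TaoAveragedCascadeSteps.lean`) makes the elementary inequalities behind these sentences
explicit, for the normalisation (3.7) (`|ξ₁⁰| = |ξ₃⁰| = 1`, `|ξ₂⁰| = √2`) and `0 < ε₀ ≤ 1/100`:

* `abs_lt_two_of_freqCutoff_ne_zero`, `eta_nonneg`, `eta_le_one`, `scaleWeight_le_one`,
  `enorm_scaleWeight_le_one`, `measurable_scaleWeight` — bookkeeping for `φ`, `η` and the weights of `B_{η,ρ,n}`;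
* `scaleWeight_ne_zero_unique`, `tsum_enorm_scaleWeight_le_one` — **at each frequency pair at most
  one scale `n` contributes to `ρ η`** (the balls `(1+ε₀)ⁿ B(ξ₁⁰, 2ε₀²)` have disjoint traces on
  rays), so `Σₙ |weightₙ| ≤ 1`;
* `normShell r κ = {| |ξ| - r | < κ}` and `scaleWeight_zero_regions` — **where the weight of
  `B_{η,ρ,0}` is non-zero, `| |ξ₁| - 1 | < 2ε₀²`, `| |ξ₂| - √2 | < 30ε₀²`, `| |ξ₃| - 1 | < 30ε₀²`**;
* `localInnerSq`, `localOuterSq`, `localShell_lt`, … — the shells `{r² - 8ε₀³ < |ξ|² < r² + 8ε₀³}` supporting the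
  localised symbols `m χ_{r,4ε₀³}` (`shellCutoff`), the admissibility `B < (1+ε₀)² A` of these shells
  for `periodise` (`localShell_lt`), the inclusion of the regions above in the fundamental scale
  shell (`normShell_subset_fundamental`), and `shellCutoff = 1` on the balls `B(ξⱼ⁰, ε₀³)`
  carrying `ψ̂ⱼ` (`shellCutoff_eq_one_of_mem_closedBall`).

## References

* T. Tao, J. Amer. Math. Soc. 29 (2016), 601–674, arXiv:1402.0290v3, §3.3–§3.4 pp. 16–17, (3.7).
  Key `Tao2016AveragedNS`.
-/

noncomputable section

open MeasureTheory Set Filter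
open scoped ENNReal NNReal

namespace Literature.Analysis.FluidPDE.Tao2016

/-- Local notation for physical / frequency space `ℝ³`. -/
local notation "ℝ³" => EuclideanSpace ℝ (Fin 3)

/-! ### Bookkeeping for `φ`, `η`, and the weights -/

/-- Where `φ ≠ 0`, the argument is in `(-2, 2)`. [cite: Tao2016AveragedNS, §3.3 p. 16] -/
theorem abs_lt_two_of_freqCutoff_ne_zero {t : ℝ} (h : freqCutoff t ≠ 0) : |t| < 2 := by
  by_contra h'
  exact h (freqCutoff_eq_zero (not_lt.1 h'))

/-- `|φ| ≤ 1`. [folklore] -/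
theorem abs_freqCutoff_le_one (t : ℝ) : |freqCutoff t| ≤ 1 := by
  rw [abs_of_nonneg (freqCutoff_nonneg t)]
  exact freqCutoff_le_one t

/-- `0 ≤ η`. [folklore] -/
theorem eta_nonneg (ε₀ N₁ N₂ N₃ : ℝ) : 0 ≤ eta ε₀ N₁ N₂ N₃ :=
  mul_nonneg (freqCutoff_nonneg _) (freqCutoff_nonneg _)

/-- `η ≤ 1`. [folklore] -/
theorem eta_le_one (ε₀ N₁ N₂ N₃ : ℝ) : eta ε₀ N₁ N₂ N₃ ≤ 1 :=
  mul_le_one₀ (freqCutoff_le_one _) (freqCutoff_nonneg _) (freqCutoff_le_one _)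

/-- `0 ≤ weightₙ ≤ 1`: the weights of `B_{η,ρ,n}` take values in `[0,1]`. [folklore] -/
theorem scaleWeight_nonneg (ε₀ : ℝ) (n : ℤ) (p : ℝ³ × ℝ³) : 0 ≤ scaleWeight ε₀ n p :=
  mul_nonneg (freqCutoff_nonneg _) (eta_nonneg _ _ _ _)

/-- `weightₙ ≤ 1`. [folklore] -/
theorem scaleWeight_le_one (ε₀ : ℝ) (n : ℤ) (p : ℝ³ × ℝ³) : scaleWeight ε₀ n p ≤ 1 :=
  mul_le_one₀ (freqCutoff_le_one _) (eta_nonneg _ _ _ _) (eta_le_one _ _ _ _)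

/-- `‖weightₙ‖ₑ ≤ 1`. [folklore] -/
theorem enorm_scaleWeight_le_one (ε₀ : ℝ) (n : ℤ) (p : ℝ³ × ℝ³) : ‖scaleWeight ε₀ n p‖ₑ ≤ 1 := by
  rw [Real.enorm_eq_ofReal (scaleWeight_nonneg ε₀ n p)]
  exact ENNReal.ofReal_le_one.2 (scaleWeight_le_one ε₀ n p)

/-- The comparability weight `(ξ₁, ξ₂) ↦ η(|ξ₁|, |ξ₂|, |ξ₃|)` is measurable (continuous off
`ξ₁ = 0`; the division by `|ξ₁|` is Mathlib's total division). [folklore] -/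
theorem measurable_eta_norm (ε₀ : ℝ) :
    Measurable fun p : ℝ³ × ℝ³ => eta ε₀ ‖p.1‖ ‖p.2‖ ‖-p.1 - p.2‖ := by
  have hφ : Measurable freqCutoff := (contDiff_freqCutoff (n := 0)).continuous.measurable
  have h1 : Measurable fun p : ℝ³ × ℝ³ => ‖p.1‖ := measurable_fst.norm
  have h2 : Measurable fun p : ℝ³ × ℝ³ => ‖p.2‖ := measurable_snd.norm
  have h3 : Measurable fun p : ℝ³ × ℝ³ => ‖-p.1 - p.2‖ := (measurable_fst.neg.sub measurable_snd).norm
  unfold eta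
  exact (hφ.comp (((h2.div h1).sub measurable_const).div measurable_const)).mul
    (hφ.comp (((h3.div h1).sub measurable_const).div measurable_const))

/-- The weights of `B_{η,ρ,n}` are measurable. [folklore] -/
theorem measurable_scaleWeight (ε₀ : ℝ) (n : ℤ) : Measurable (scaleWeight ε₀ n) := by
  have hφ : Measurable freqCutoff := (contDiff_freqCutoff (n := 0)).continuous.measurable
  have h1 : Measurable fun p : ℝ³ × ℝ³ => ((1 + ε₀) ^ (-n) : ℝ) • p.1 - xi0 0 :=
    (measurable_fst.const_smul ((1 + ε₀) ^ (-n) : ℝ)).sub measurable_const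
  have h2 : Measurable fun p : ℝ³ × ℝ³ => ‖((1 + ε₀) ^ (-n) : ℝ) • p.1 - xi0 0‖ / ε₀ ^ 2 :=
    h1.norm.div measurable_const
  have h3 : Measurable fun p : ℝ³ × ℝ³ =>
      freqCutoff (‖((1 + ε₀) ^ (-n) : ℝ) • p.1 - xi0 0‖ / ε₀ ^ 2) := hφ.comp h2
  exact h3.mul (measurable_eta_norm ε₀)

/-! ### At most one scale contributes to `ρ` at each frequency -/

/-- If the `n`-th scale factor `φ(|(1+ε₀)^{-n}ξ - ξ₁⁰|/ε₀²)` is non-zero then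
`| (1+ε₀)^{-n}|ξ| - 1 | < 2ε₀²`. [cite: Tao2016AveragedNS, §3.3 p. 16] -/
theorem abs_sub_one_lt_of_scaleFactor_ne_zero {ε₀ : ℝ} (hε : 0 < ε₀) {n : ℤ} {ξ : ℝ³}
    (h : freqCutoff (‖((1 + ε₀) ^ (-n) : ℝ) • ξ - xi0 0‖ / ε₀ ^ 2) ≠ 0) :
    |((1 + ε₀) ^ (-n) : ℝ) * ‖ξ‖ - 1| < 2 * ε₀ ^ 2 := by
  have hq : 0 < 1 + ε₀ := by linarith
  have h2 := abs_lt_two_of_freqCutoff_ne_zero h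
  have hε2 : 0 < ε₀ ^ 2 := pow_pos hε 2
  rw [abs_div, abs_of_pos hε2, div_lt_iff₀ hε2, abs_of_nonneg (norm_nonneg _)] at h2
  have hrev : |‖((1 + ε₀) ^ (-n) : ℝ) • ξ‖ - ‖xi0 0‖| ≤ ‖((1 + ε₀) ^ (-n) : ℝ) • ξ - xi0 0‖ :=
    abs_norm_sub_norm_le _ _
  rw [norm_xi0_zero, norm_smul, Real.norm_of_nonneg (zpow_nonneg hq.le _)] at hrev
  linarith

/-- **At most one scale**: for `0 < ε₀ ≤ 1/5`, if both the `n`-th and the `n'`-th scale factors are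
non-zero at `ξ` then `n = n'` (consecutive scales differ by the factor `1+ε₀`, while each factor
confines `(1+ε₀)^{-n}|ξ|` to `(1-2ε₀², 1+2ε₀²)`; "`ρ` is supported on the union of the balls
`(1+ε₀)ⁿ · B(ξ₁⁰, 2ε₀²)`"). [cite: Tao2016AveragedNS, §3.3 p. 16] -/
theorem scaleFactor_ne_zero_unique {ε₀ : ℝ} (hε : 0 < ε₀) (hε1 : ε₀ ≤ 1 / 5) {n n' : ℤ} {ξ : ℝ³}
    (hn : freqCutoff (‖((1 + ε₀) ^ (-n) : ℝ) • ξ - xi0 0‖ / ε₀ ^ 2) ≠ 0)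
    (hn' : freqCutoff (‖((1 + ε₀) ^ (-n') : ℝ) • ξ - xi0 0‖ / ε₀ ^ 2) ≠ 0) : n = n' := by
  have hq : 1 < 1 + ε₀ := by linarith
  have hq0 : 0 < 1 + ε₀ := by linarith
  have h1 := abs_sub_one_lt_of_scaleFactor_ne_zero hε hn
  have h2 := abs_sub_one_lt_of_scaleFactor_ne_zero hε hn'
  rw [abs_lt] at h1 h2
  by_contra hne
  -- without loss of generality `n < n'` (the statement is symmetric)
  wlog hlt : n < n' generalizing n n'
  · exact this hn' hn h2 h1 (Ne.symm hne) (lt_of_le_of_ne (not_lt.1 hlt) (Ne.symm hne))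
  set t : ℝ := (1 + ε₀) ^ (-n) * ‖ξ‖ with ht
  have hle : (1 : ℤ) ≤ n' - n := by omega
  -- `(1+ε₀)^{-n'}|ξ| = (1+ε₀)^{-(n'-n)} t ≤ t/(1+ε₀)`
  have hrel : ((1 + ε₀) ^ (-n') : ℝ) * ‖ξ‖ = ((1 + ε₀) ^ (n' - n))⁻¹ * t := by
    rw [ht, ← mul_assoc, ← zpow_neg, ← zpow_add₀ hq0.ne']
    congr 2
    ring
  have hpow : (1 + ε₀) ≤ (1 + ε₀) ^ (n' - n) := by
    calc (1 + ε₀) = (1 + ε₀) ^ (1 : ℤ) := (zpow_one _).symm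
      _ ≤ (1 + ε₀) ^ (n' - n) := zpow_le_zpow_right₀ hq.le hle
  have ht0 : 0 ≤ t := mul_nonneg (zpow_nonneg hq0.le _) (norm_nonneg _)
  have hbig : 0 < (1 + ε₀) ^ (n' - n) := zpow_pos hq0 _
  have hup : ((1 + ε₀) ^ (n' - n))⁻¹ * t ≤ (1 + ε₀)⁻¹ * t :=
    mul_le_mul_of_nonneg_right ((inv_le_inv₀ hbig hq0).2 hpow) ht0
  rw [hrel] at h2
  -- combine: `1 - 2ε² < t/(1+ε₀)` and `t < 1 + 2ε²`
  have h3 : 1 - 2 * ε₀ ^ 2 < (1 + ε₀)⁻¹ * t := by linarith [h2.1]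
  rw [lt_inv_mul_iff₀ hq0] at h3
  nlinarith [h1.2]

/-- The same uniqueness for the weights of `B_{η,ρ,n}` (which contain the scale factors). [cite: Tao2016AveragedNS, §3.3–3.4 p. 16] -/
theorem scaleWeight_ne_zero_unique {ε₀ : ℝ} (hε : 0 < ε₀) (hε1 : ε₀ ≤ 1 / 5) {n n' : ℤ}
    {p : ℝ³ × ℝ³} (hn : scaleWeight ε₀ n p ≠ 0) (hn' : scaleWeight ε₀ n' p ≠ 0) : n = n' :=
  scaleFactor_ne_zero_unique hε hε1 (left_ne_zero_of_mul hn) (left_ne_zero_of_mul hn')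

/-- **`Σₙ |weightₙ| ≤ 1` pointwise** (at most one non-zero summand, each in `[0,1]`): the
domination needed to sum `B_{η,ρ} = -πi Σₙ (1+ε₀)^{5n/2} B_{η,ρ,n}` absolutely. [cite: Tao2016AveragedNS, §3.4 p. 16] -/
theorem tsum_enorm_scaleWeight_le_one {ε₀ : ℝ} (hε : 0 < ε₀) (hε1 : ε₀ ≤ 1 / 5) (p : ℝ³ × ℝ³) :
    ∑' n : ℤ, ‖scaleWeight ε₀ n p‖ₑ ≤ 1 := by
  by_cases h : ∃ n : ℤ, scaleWeight ε₀ n p ≠ 0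
  · obtain ⟨n₀, hn₀⟩ := h
    rw [tsum_eq_single n₀]
    · exact enorm_scaleWeight_le_one ε₀ n₀ p
    · intro n hn
      have : scaleWeight ε₀ n p = 0 := by
        by_contra h'
        exact hn (scaleWeight_ne_zero_unique hε hε1 h' hn₀)
      rw [this, enorm_zero]
  · simp only [not_exists, not_not] at h
    simp [h]

/-! ### Where the weight of `B_{η,ρ,0}` lives -/

/-- The **frequency region** `{ξ : | |ξ| - r | < κ}` (a thin spherical shell about radius `r`). [folklore] -/
def normShell (r κ : ℝ) : Set ℝ³ := {ξ | |‖ξ‖ - r| < κ}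

/-- Frequency regions are monotone in the width. [folklore] -/
theorem normShell_mono (r : ℝ) {κ κ' : ℝ} (h : κ ≤ κ') : normShell r κ ⊆ normShell r κ' :=
  fun _ hξ => lt_of_lt_of_le hξ h

/-- `√2 ∈ [1, 3/2]`. [folklore] -/
theorem one_le_sqrt_two : (1 : ℝ) ≤ Real.sqrt 2 := by
  rw [show (1 : ℝ) = Real.sqrt 1 from Real.sqrt_one.symm]
  exact Real.sqrt_le_sqrt (by norm_num)

/-- `√2 ≤ 3/2`. [folklore] -/
theorem sqrt_two_le : Real.sqrt 2 ≤ 3 / 2 := by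
  nlinarith [Real.sq_sqrt (show (0 : ℝ) ≤ 2 by norm_num), Real.sqrt_nonneg 2]

/-- **Where the weight of `B_{η,ρ,0}` is non-zero** (`0 < ε₀ ≤ 1/5`): `| |ξ₁| - 1 | < 2ε₀²`
(`φ(|ξ₁ - ξ₁⁰|/ε₀²) ≠ 0`), and `| |ξ₂| - √2 | < 30ε₀²`, `| |ξ₃| - 1 | < 30ε₀²`
(`η ≠ 0`: `|ξ₂|/|ξ₁| ∈ √2 ± 20ε₀²`, `|ξ₃|/|ξ₁| ∈ 1 ± 20ε₀²`). [cite: Tao2016AveragedNS, §3.3–3.4 pp. 16–17] -/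
theorem scaleWeight_zero_regions {ε₀ : ℝ} (hε : 0 < ε₀) (hε1 : ε₀ ≤ 1 / 5) {p : ℝ³ × ℝ³}
    (h : scaleWeight ε₀ 0 p ≠ 0) :
    p.1 ∈ normShell 1 (2 * ε₀ ^ 2) ∧ p.2 ∈ normShell (Real.sqrt 2) (30 * ε₀ ^ 2) ∧
      -p.1 - p.2 ∈ normShell 1 (30 * ε₀ ^ 2) := by
  have hε2 : 0 < ε₀ ^ 2 := pow_pos hε 2
  have hε25 : ε₀ ^ 2 ≤ 1 / 25 := by nlinarith
  have hφ := left_ne_zero_of_mul h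
  have hη := right_ne_zero_of_mul h
  -- slot 1
  have h1 : |‖p.1‖ - 1| < 2 * ε₀ ^ 2 := by
    have := abs_sub_one_lt_of_scaleFactor_ne_zero hε hφ
    simpa using this
  have h1' := h1
  rw [abs_lt] at h1'
  have hN1 : 0 < ‖p.1‖ := by nlinarith
  -- the two factors of `η`
  unfold eta at hη
  have ha := abs_lt_two_of_freqCutoff_ne_zero (left_ne_zero_of_mul hη)
  have hb := abs_lt_two_of_freqCutoff_ne_zero (right_ne_zero_of_mul hη)
  rw [norm_xi0_zero, norm_xi0_one, div_one] at ha
  rw [norm_xi0_zero, norm_xi0_two, div_one] at hb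
  have h10 : 0 < 10 * ε₀ ^ 2 := by positivity
  rw [abs_div, abs_of_pos h10, div_lt_iff₀ h10] at ha hb
  -- slot 2: `| |ξ₂| - √2 |ξ₁| | < 20ε² |ξ₁|`
  have ha' : |‖p.2‖ - Real.sqrt 2 * ‖p.1‖| < 20 * ε₀ ^ 2 * ‖p.1‖ := by
    have : ‖p.2‖ - Real.sqrt 2 * ‖p.1‖ = (‖p.2‖ / ‖p.1‖ - Real.sqrt 2) * ‖p.1‖ := by
      field_simp
    rw [this, abs_mul, abs_of_pos hN1]
    nlinarith
  -- slot 3: `| |ξ₃| - |ξ₁| | < 20ε² |ξ₁|`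
  have hb' : |‖-p.1 - p.2‖ - ‖p.1‖| < 20 * ε₀ ^ 2 * ‖p.1‖ := by
    have : ‖-p.1 - p.2‖ - ‖p.1‖ = (‖-p.1 - p.2‖ / ‖p.1‖ - 1) * ‖p.1‖ := by
      field_simp
    rw [this, abs_mul, abs_of_pos hN1]
    nlinarith
  refine ⟨h1, ?_, ?_⟩
  · show |‖p.2‖ - Real.sqrt 2| < 30 * ε₀ ^ 2
    rw [abs_lt] at ha' ⊢
    have hs := sqrt_two_le
    have hs1 := one_le_sqrt_two
    constructor <;> nlinarith
  · show |‖-p.1 - p.2‖ - 1| < 30 * ε₀ ^ 2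
    rw [abs_lt] at hb' ⊢
    constructor <;> nlinarith

/-! ### The shells of the localised symbols -/

/-- The squared inner/outer radii `r² ∓ 8ε₀³` of the shell supporting the localised symbol
`m χ_{r,4ε₀³}`. [cite: Tao2016AveragedNS, §3.4 p. 17] -/
def localInnerSq (r ε₀ : ℝ) : ℝ := r ^ 2 - 8 * ε₀ ^ 3

/-- See `localInnerSq`. [cite: Tao2016AveragedNS, §3.4 p. 17] -/
def localOuterSq (r ε₀ : ℝ) : ℝ := r ^ 2 + 8 * ε₀ ^ 3

/-- The cut-off symbol `m χ_{r,4ε₀³}` is supported in the shell `{r² - 8ε₀³ < |ξ|² < r² + 8ε₀³}`. [cite: Tao2016AveragedNS, §3.4 p. 17] -/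
theorem isShellSupported_mul_shellCutoff (m : ℝ³ → ℂ) (r : ℝ) {ε₀ : ℝ} (hε : 0 < ε₀) :
    IsShellSupported (localInnerSq r ε₀) (localOuterSq r ε₀)
      (fun ξ => m ξ * shellCutoff r (4 * ε₀ ^ 3) ξ) := by
  intro ξ hξ
  have h := abs_lt_of_shellCutoff_ne_zero (by positivity) (right_ne_zero_of_mul hξ)
  rw [abs_lt] at h
  unfold localInnerSq localOuterSq
  constructor <;> linarith [h.1, h.2]

/-- The inner squared radius is positive (`1 ≤ r`, `0 < ε₀ ≤ 1/5`). [folklore] -/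
theorem localInnerSq_pos {r ε₀ : ℝ} (hr : 1 ≤ r) (hε : 0 < ε₀) (hε1 : ε₀ ≤ 1 / 5) :
    0 < localInnerSq r ε₀ := by
  unfold localInnerSq
  nlinarith [pow_pos hε 3, mul_pos hε hε]

/-- The outer squared radius is non-negative. [folklore] -/
theorem localOuterSq_nonneg (r : ℝ) {ε₀ : ℝ} (hε : 0 < ε₀) : 0 ≤ localOuterSq r ε₀ := by
  unfold localOuterSq
  positivity

/-- **Admissibility of the shells for periodisation**: `r² + 8ε₀³ < (1+ε₀)² (r² - 8ε₀³)` for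
`1 ≤ r` and `0 < ε₀ ≤ 1/5` (consecutive scales of the localised symbols have disjoint supports). [cite: Tao2016AveragedNS, §3.4 p. 17] -/
theorem localShell_lt {r ε₀ : ℝ} (hr : 1 ≤ r) (hε : 0 < ε₀) (hε1 : ε₀ ≤ 1 / 5) :
    localOuterSq r ε₀ < (1 + ε₀) ^ 2 * localInnerSq r ε₀ := by
  unfold localInnerSq localOuterSq
  have hr2 : 1 ≤ r ^ 2 := by nlinarith
  nlinarith [pow_pos hε 3, mul_pos hε hε, mul_pos (mul_pos hε hε) (mul_pos hε hε)]

/-- **The frequency regions of `B_{η,ρ,0}` lie in the fundamental scale shell of the localised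
symbols**: for `1 ≤ r ≤ 3/2`, `0 < ε₀ ≤ 1/100` and `| |ξ| - r | < 30ε₀²`,
`(r² + 8ε₀³)/(1+ε₀)² < |ξ|² < (1+ε₀)² (r² - 8ε₀³)` (an `O(ε₀²)`-thin shell inside an
`O(ε₀)`-thick one: "if `ε₀` is small enough"). [cite: Tao2016AveragedNS, §3.4 p. 17] -/
theorem normShell_subset_fundamental {r ε₀ : ℝ} (hr : 1 ≤ r) (hr' : r ≤ 3 / 2) (hε : 0 < ε₀)
    (hε1 : ε₀ ≤ 1 / 100) {ξ : ℝ³} (hξ : ξ ∈ normShell r (30 * ε₀ ^ 2)) :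
    localOuterSq r ε₀ / (1 + ε₀) ^ 2 < ‖ξ‖ ^ 2 ∧ ‖ξ‖ ^ 2 < (1 + ε₀) ^ 2 * localInnerSq r ε₀ := by
  unfold localInnerSq localOuterSq
  have hq : 0 < (1 + ε₀) ^ 2 := by positivity
  have hξ' : |‖ξ‖ - r| < 30 * ε₀ ^ 2 := hξ
  rw [abs_lt] at hξ'
  obtain ⟨hlo, hhi⟩ := hξ'
  have ht0 : 0 ≤ ‖ξ‖ := norm_nonneg _
  have hε2 : 0 < ε₀ ^ 2 := pow_pos hε 2
  have hε3 : 0 < ε₀ ^ 3 := pow_pos hε 3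
  have hεsmall : ε₀ ^ 2 ≤ ε₀ / 100 := by nlinarith
  constructor
  · -- lower bound
    rw [div_lt_iff₀ hq]
    have hpos : 0 ≤ r - 30 * ε₀ ^ 2 := by nlinarith
    have h1 : (r - 30 * ε₀ ^ 2) ^ 2 ≤ ‖ξ‖ ^ 2 := by nlinarith
    have h2 : r ^ 2 - 90 * ε₀ ^ 2 ≤ (r - 30 * ε₀ ^ 2) ^ 2 := by nlinarith
    have h3 : (1 + 2 * ε₀) * (r ^ 2 - 90 * ε₀ ^ 2) ≤ ‖ξ‖ ^ 2 * (1 + ε₀) ^ 2 := by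
      have h4 : 0 ≤ r ^ 2 - 90 * ε₀ ^ 2 := by nlinarith
      nlinarith
    nlinarith
  · -- upper bound
    have h1 : ‖ξ‖ ^ 2 < (r + 30 * ε₀ ^ 2) ^ 2 := by nlinarith
    have h2 : (r + 30 * ε₀ ^ 2) ^ 2 ≤ r ^ 2 + 91 * ε₀ ^ 2 := by nlinarith
    have h3 : (1 + 2 * ε₀) * (r ^ 2 - 8 * ε₀ ^ 3) ≤ (1 + ε₀) ^ 2 * (r ^ 2 - 8 * ε₀ ^ 3) := by
      have h4 : 0 ≤ r ^ 2 - 8 * ε₀ ^ 3 := by nlinarith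
      nlinarith
    nlinarith

/-- **The cut-off `χ_{r,4ε₀³}` equals `1` on the ball `B(ξ₀, ε₀³)`, `|ξ₀| = r`** (`1 ≤ r ≤ 3/2`,
`0 < ε₀ ≤ 1`): `| |ξ|² - r² | = | |ξ| - r | (|ξ| + r) ≤ ε₀³ · 4`. This is what makes the
localisation invisible to `C₀` (`ψ̂ⱼ ⊆ B(ξⱼ⁰, ε₀³)`). [cite: Tao2016AveragedNS, §3.4 p. 17] -/
theorem shellCutoff_eq_one_of_mem_closedBall {r ε₀ : ℝ} (hr : 0 ≤ r) (hr' : r ≤ 3 / 2) (hε : 0 < ε₀)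
    (hε1 : ε₀ ≤ 1) {ξ₀ ξ : ℝ³} (hξ₀ : ‖ξ₀‖ = r) (hξ : ξ ∈ Metric.closedBall ξ₀ (ε₀ ^ 3)) :
    shellCutoff r (4 * ε₀ ^ 3) ξ = 1 := by
  refine shellCutoff_eq_one (by positivity) ?_
  rw [Metric.mem_closedBall, dist_eq_norm] at hξ
  have hε3 : ε₀ ^ 3 ≤ 1 := pow_le_one₀ hε.le hε1
  have hd : |‖ξ‖ - r| ≤ ε₀ ^ 3 := by
    rw [← hξ₀]
    exact (abs_norm_sub_norm_le ξ ξ₀).trans hξ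
  have hsum : ‖ξ‖ + r ≤ 4 := by
    rw [abs_le] at hd
    linarith
  have hsum0 : 0 ≤ ‖ξ‖ + r := by positivity
  calc |‖ξ‖ ^ 2 - r ^ 2| = |‖ξ‖ - r| * (‖ξ‖ + r) := by
        rw [show ‖ξ‖ ^ 2 - r ^ 2 = (‖ξ‖ - r) * (‖ξ‖ + r) by ring, abs_mul, abs_of_nonneg hsum0]
    _ ≤ ε₀ ^ 3 * 4 := mul_le_mul hd hsum hsum0 (by positivity)
    _ = 4 * ε₀ ^ 3 := by ring

/-- The base frequencies have norms in `[1, 3/2]`: `|ξ₁⁰| = |ξ₃⁰| = 1`, `|ξ₂⁰| = √2`. [cite: Tao2016AveragedNS, (3.7)] -/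
theorem one_le_norm_xi0 (j : Fin 3) : 1 ≤ ‖xi0 j‖ := by
  fin_cases j
  · simp [norm_xi0_zero]
  · simp [norm_xi0_one]
  · simp [norm_xi0_two]

/-- See `one_le_norm_xi0` (the tree's `norm_xi0_le`, in `TaoAveragedCascadeStepsProofs.lean`, is the same bound; restated here to keep the import light). [cite: Tao2016AveragedNS, (3.7)] -/
theorem norm_xi0_le_three_halves (j : Fin 3) : ‖xi0 j‖ ≤ 3 / 2 := by
  fin_cases j
  · simp [norm_xi0_zero]
    norm_num
  · simp [norm_xi0_one, sqrt_two_le]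
  · simp [norm_xi0_two]
    norm_num

/-- The radii of the three frequency regions of `B_{η,ρ,0}` are the `|ξⱼ⁰|`. [cite: Tao2016AveragedNS, (3.7)] -/
theorem scaleWeight_zero_regions' {ε₀ : ℝ} (hε : 0 < ε₀) (hε1 : ε₀ ≤ 1 / 5) {p : ℝ³ × ℝ³}
    (h : scaleWeight ε₀ 0 p ≠ 0) :
    p.1 ∈ normShell ‖xi0 0‖ (30 * ε₀ ^ 2) ∧ p.2 ∈ normShell ‖xi0 1‖ (30 * ε₀ ^ 2) ∧
      -p.1 - p.2 ∈ normShell ‖xi0 2‖ (30 * ε₀ ^ 2) := by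
  obtain ⟨h1, h2, h3⟩ := scaleWeight_zero_regions hε hε1 h
  rw [norm_xi0_zero, norm_xi0_one, norm_xi0_two]
  exact ⟨normShell_mono 1 (by nlinarith [pow_pos hε 2]) h1, h2, h3⟩

end Literature.Analysis.FluidPDE.Tao2016
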